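import Summits.QuantumFields.YangMills.Theorems.BalabanUVNodesN24K1R9ByNameOfOpenStubsGridGChildrenSplitSlot8Thm1AEPosAtGaussPinPrintedZYP
import Summits.QuantumFields.YangMills.Theorems.BalabanUVNodesN24K1R9ByNameSlot8Thm1AEInstPerKappaPrimeGuarded
import Summits.QuantumFields.YangMills.Theorems.BalabanUVNodesN05SubBP2DK2PerKappaSlotExistsOfBindersLettersPerDoorL
import Literature.MathematicalPhysics.QuantumFieldTheory.Balaban1983to89.B9Thm33BindersUniformZdPerNestedEta
import Literature.MathematicalPhysics.QuantumFieldTheory.Balaban1983to89.Node00.Record12NumericsFamilyFiniteDim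

/-!
# NODE N24 (B2) — THE K1 FACE OF RECORD WITH N06's FIVE ANALYTIC BINDERS CONSUMED, η-LAW-FREE (dag-n06-b g26's road (i) `B9Thm33BindersUniformZdPerNestedEta.binders_uniform`, the η-scaling of the record; INTENT-73), AT THE PRINTED NORMALISATION, STAGE-3 CHILDREN DOOR-FREE, N06's LEAF AT `Y9OfRecordP`: K1⁹ `StabilityBRunRowsAtRecordR13SepCoPHV` (stmt-QuantumFields-27364) BY ITS ROUTE NAME
# ON THE V21-G ∕ GAUSS-PIN SLOT ROAD AT THE WITNESS SLOT OF RECORD `Slot8κ′`, AT THE Z MEMBER WITH `logz :=` PRINT's [I] (0.15) `log z(g_j², ε)`; N05 READ THROUGH ζ-L (p673108) BY NAME,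
# N05 ∕ N06 ∕ N10 DISPLAYED AT THE FAMILY's STAGE-3 DICTIONARY `stage3OfFamily F` (door-free, letter-free — `(θZ).toStage3Params = stage3OfFamily F` is `rfl`), N13's LEVEL-0 FACE CONSUMED (CLAIM-65)

TRACK A (YM-PLAN §2d, node N24 of 28 = binder B2), seat `pub-ymgap-dag-n24-c` (R134 s2; gen 14, INTENT-73 = INTENT-72 (p686665) with THE η-LAW DROPPED: dag-n06-b g26's FILE H `B9Thm33BindersUniformZdPerNestedEta.IdxB8SubDPerκ.binders_uniform` (= p682259's `binders_uniform_of_eta_law` VERBATIM minus `(ηfun) (hηk)`, road (i) — the η-SCALING of the genuine periodic record, FILE G `B9Eq326DeltaAEtaScalingZdPer`) supplies ζ-L's five N06 binder families with ONE constant set from the tracial state data `(τ, C_τ)` and the Hölder pair alone (uniformly in `ops₀`, `M`); glue `a_S := a_T`, `C_β ↦ max C_β 1`.  Displayed at the N05∕N06 slot after this file: `(τ, C_τ)` + Hölder pair (`0 ≤ β`, integer lengths) + [4]'s letter families `hLet` (with (L4)) ∕ `SLetUB` and their five constants — NO analytic binder, NO η-law, NO director's word needed.  (dag-n06-b's FILE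 I `…OfLettersPerDoorLN06Served` gives the same by one `exact`; this file keeps the K1 face independent of it.))
Summits lane; count-neutral).  [B8] = [Balaban1985RegularSpaces]; [4] = [Balaban1985BackgroundPropagators]; [V] = [Balaban1989LargeFieldII]; [III] = [Balaban1988Convergent]; [I] = [Balaban1987RG1].

WHY.  (1) p675424 (gen 13, CLAIM-64) is the K1 face of record: K1⁹ BY NAME on the V21-G ∕ θᴳᶻ slot road at `Slot8κ′` with N05 read through ζ-L — at DEF-1's Z member with the normalisation
letters `Efl logz : T4Family → RunParams → ℕ → ℝ` FREE and door-blind; dag-n13-w3 (p651640 ∕ p648246): K1⁹'s witness MUST normalise with slope `d(𝔤)∕4` = print's `z`; dag-n13-w1 (p643638):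
at the printed `z` (a door-DEPENDENT letter) the level-0 face of [III] Cor. 3 (2.50) is a theorem; this seat's CLAIM-65 re-pointed the `Slot8`-parametric slot road at the printed normalisation and
took N13's level-0 face off the bill.  (2) KERNEL FACT surfaced while typing: the Stage-3 view of EVERY member of the K0 witness family is the family dictionary — `(theta13OfThm1CCMWZ F 2 j γ … E ℓ).toStage3Params
= stage3OfFamily F` and `(theta13OfThm1CCMW F 2 j γ …).toStage3Params = stage3OfFamily F` are `rfl` — so the Stage-3-keyed children (N05's slot hence N06's binders, N06's `B9LeafX`, N10's
`B13LeafOfRecord`) read NEITHER the door tuple NOR the normalisation letters: p675424's `hN05` carried twelve idle door binders and 252 copies of the witness term.  THIS FILE is p675424 re-keyed on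
CLAIM-65 with those three families displayed ONCE PER `F` at `stage3OfFamily F`: `Slot8 :=` the κ′ slot of record (p658298's λ-term VERBATIM), `h05 :=` ζ-L's `exists_residB8_slot8κ'_of_bindersLettersPer_doorL
(stage3OfFamily F) …` BY NAME, `h06 ∕ h10` fed constantly in the door.

WHAT THIS FILE PROVES (1 theorem, 0 `def`, 0 `sorry`; standard axioms).  ★★★★ `N24_stabilityBRunRowsAtRecordR13SepCoPHV_byName_of_openStubsGridG_of_n06TorusDataLettersLSlot8KappaPrime_stage3DoorFree_n13LevelZero_atGaussPinPrintedZ_pinYP_of_runRowsCont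
(M₁ R) (hM₁ : 1 ≤ M₁) (ε) (hεz : 0 < ε) (Efl : door-wise) (h1G3 h3A'G3 : V21-G's REGISTERED stub texts) (hN05 : ∀ F, ζ-L's displayed binders VERBATIM at `stage3OfFamily F`) (h06 h10 : ∀ F, at `stage3OfFamily F`)
(h07 h08) (h09 h09T h11N : door-wise at the printed-z member ∕ its Gauss pin) (hEfl : Efl's volume bound) (h13pos : N13's a.e. (2.50) rows at levels ≥ 1 only) (hrowsR) : …StabilityBRunRowsAtRecordR13SepCoPHV`.

WHICH CHILD BLOCKS AT THE PRINTED-z GAUSS PIN AFTER THIS FILE (= its hypotheses): K0⁷ V21-G stubs 1-G‴ ∧ 3ᴬ′-G‴ (REGISTERED 0∕2); **per `F` only, at `stage3OfFamily F`**: N05 → `hN05` = N06's five binders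
(`InvAtHIPer`, `GlobAtIPer`, `HolderAtIH2Per`, `SrcAtIPer`, `SrcHolderAtIH2Per`) at print-class periodic members + N06's torus record data∕constants + Hölder pair + [4]'s letters `hLet` (with (L4)) ∕
`SLetUB` + `1 ≤ M₁`; **N06 `h06` (`B9LeafX (Y9OfRecordP 2 (stage3OfFamily F) Mstar ops)` — N06's object of record, `ops` free)**; N10 `h10` (`B13LeafOfRecord (stage3OfFamily F) …`); per `F`: N07 `h07`, N08 `h08`; **per door tuple**: N09 `h09` +
`h09T`, N11 `h11N`, N13 = a.e. rows at levels ≥ 1 (`h13pos`) + `Efl`'s volume bound (`hEfl`), NODE O `hrowsR`; `0 < ε`.  OFF the bill: N13's level 0, the letter `logz`, N05's own content.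

HONEST FRAMING.  Composition BY NAME (one `refine` + one `exact`); NO estimate of Bałaban's proved here; every family DISPLAYED as a hypothesis (CONDITIONAL, audit `proof.conditional`); `Efl`, `ε` FREE;
NOT a claim that the printed-z member IS K1⁹'s witness; NO v10 ∕ V21-G stub proved or closed; N05's discharge is the chair's booking (R467) on the N05 lane's record, not this file's; N06 ∕ N10 ∕ N11 ∕
N13 NOT discharged; N24 COMPOSITE — no count moved (typed 28∕28 · discharged 7∕27 · A 7∕28); K0⁷ «V21-G 0∕2 (+2′)» ∕ K1⁹ stmt-QuantumFields-27364 (DECIDING; v10 0∕6, HARD FREEZE respected) ∕ K3⁸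
OPEN; one finite 𝕋⁴ programme at fixed ε, Bałaban AS PRINTED; R4 = the conditional finite-𝕋⁴ rung `BalabanLadder.UV` only — NOT continuum ∕ ℝ⁴ ∕ OS ∕ mass gap ∕ Clay: the Yang–Mills mass gap
is NOT proved by any of this.  No `sorry`, `def`, `instance`, `notation`.
-/

noncomputable section

open scoped Matrix.Norms.L2Operator BigOperators
open Filter Topology MeasureTheory

namespace Summit.QuantumFields.YangMills.BalabanUVNodes.N24K1FaceN06BindersJunctionLSlot8KappaPrimeAtGaussPinPrintedZYP

open Literature.MathematicalPhysics.QuantumFieldTheory.Balaban1983to89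
open Literature.MathematicalPhysics.QuantumFieldTheory.Balaban1983to89.Node00
open DagBinding T4Continuum T4DatumAssembly FlowStepRuns AveragingRT
open FlowStep (HBeta RGEqH prefixOf prefixOf_apply BetaLowerH BetaUpperH Box mem_box clampPrefix Y)
open Literature.MathematicalPhysics.QuantumFieldTheory.Balaban1983to89.B8LeafModelZd (ZdIdx)
open Literature.MathematicalPhysics.QuantumFieldTheory.Balaban1983to89.B8TowerBondsPrinted (towerBondsP)
open Literature.MathematicalPhysics.QuantumFieldTheory.Balaban1983to89.B9SupplySockB9P3ZdSrcPer (SrcAtIPer SrcHolderAtIH2Per)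
open Literature.MathematicalPhysics.QuantumFieldTheory.Balaban1983to89.B9SupplySockB9P3ZdLetters (OpsZd)
open Literature.MathematicalPhysics.QuantumFieldTheory.Balaban1983to89.B9Eq327GreenZdHermPer (InvAtHIPer)
open Literature.MathematicalPhysics.QuantumFieldTheory.Balaban1983to89.B9SupplySockB9P3ZdPer (GlobAtIPer)
open Literature.MathematicalPhysics.QuantumFieldTheory.Balaban1983to89.B9SupplySockB9P3ZdH2Per (HolderAtIH2Per holderAtIH2Per_anti)
open Literature.MathematicalPhysics.QuantumFieldTheory.Balaban1983to89.B9SupplySockB9P3ZdAllLettersZdPer (opsAllZdPer)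
open T4TermwiseTorus (IsPeriodic)
open MatrixLog B7Prop2Explicit B7Prop1Local B7Eq92Concrete
open B8Ineq132 (InAk covDerivFwd)
open B8Eq119TwistedAxial (bgT)
open B8Eq140Level (SideTouches)
open B8Eq138LandauZd (covLap QT)
open B7Eq78Linearization (zdBlocking QprimeIter)
open B8Eq1117Concrete (XSpace)
open B8Prop5ContractionKLevel (Bd2)
open B8LambdaSpaceKLevel (wt)
open Summit.QuantumFields.YangMills.Theorems.K0V19Defs (Prop8StepCoPAt AbsBetaBoxAtThm1WitnessCCMGenAt)
open Summit.QuantumFields.YangMills.Theorems.BalabanUVNodesN11GaussianCertificateDefs (gaussPinH)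
open Summit.QuantumFields.YangMills.Theorems.BalabanUVNodesN11Sect3SupplyChainDefs (Sect3Supplier)
open Summit.QuantumFields.YangMills.Theorems.BalabanUVNodesN11Sect3SupplyChainObligationsDefs (SupplierObligations OperandRowsAlongChain)
open Summit.QuantumFields.YangMills.Theorems.BalabanUVNodesN11K1WitnessGaussPinHAtZ (provisos₁₃SepCoPH_gaussPinH_theta13OfThm1CCMWZ_door)
open Summit.QuantumFields.YangMills.BalabanUVNodes.N05SubBP2DK2PerKappaSlotExistsOfBindersLettersPerDoorL (exists_residB8_slot8κ'_of_bindersLettersPer_doorL)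
open Summit.QuantumFields.YangMills.BalabanUVNodes.N24K1R9ByNameOfOpenStubsGridGChildrenSplitSlot8Thm1AEPosAtGaussPinPrintedZYP (N24_stabilityBRunRowsAtRecordR13SepCoPHV_byName_of_openStubsGridG_of_childrenSplitSlot8N11OperandRowsThm1AEPos_atGaussPinPrintedZ_pinYP_of_runRowsCont)

/-- **★★★★ THE K1 FACE OF RECORD AT THE PRINTED NORMALISATION, STAGE-3 CHILDREN DOOR-FREE — K1⁹ `StabilityBRunRowsAtRecordR13SepCoPHV` (stmt-QuantumFields-27364) BY ITS ROUTE NAME on the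
V21-G ∕ Gauss-pin slot road at the witness slot of record `Slot8κ′`, at the Z member with `logz := log z(g_j², ε)` ([I] (0.15), door-wise), WITH N05 READ THROUGH ζ-L
`exists_residB8_slot8κ'_of_bindersLettersPer_doorL` (p673108) BY NAME, N05 ∕ N06 ∕ N10 displayed ONCE PER `F` at `stage3OfFamily F` (`(θZ).toStage3Params = stage3OfFamily F`, `rfl`), and N13's
LEVEL-0 FACE CONSUMED** (CLAIM-65).  `hN06` = an ∃-package at `θ₃ := stage3OfFamily F` of N06's tracial state data `(τ, C_τ)`, the Hölder pair (`0 ≤ β`, `0 < len v → 1 ≤ len v`), and [4]'s letter families — ζ-L's five N06 binder families being SUPPLIED by dag-n06-b's η-free `binders_uniform` (FILE H) (NODE N06's torus record data `τ, C_τ, ops₀, M ≥ 1`, N06's binder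
constants with signs, the Hölder pair `β, len`, [4]'s Prop-5 letter constants with signs, N06's FIVE binder predicates per print-class periodic member and truncation, [4]'s letter families
`hLet` (with the (L4) clause) ∕ `SLetUB`), the instance `FiniteDimensional ℝ (stage3OfFamily F).𝔸` asked INSIDE the binder and supplied in the proof (`ℂ`); the θ₃ facts `2 ≤ 4`, `5 ≤ F.L`
(`F.hL11`) discharged here; `Slot8 :=` p658298's κ′ λ-term verbatim; `h06 ∕ h10` fed constantly in the door; N13 displayed by `h13pos` (a.e. rows, levels ≥ 1) and `hEfl` only.  CONDITIONAL
(every family displayed; audit `proof.conditional`); not a closure; NO v10 ∕ V21-G stub used as proved or closed; N05's discharge is the chair's act (R467), not this file's; N06 ∕ N10 ∕ N11 ∕ N13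
NOT discharged; no count moved.
[cite: Balaban1985RegularSpaces, Lemma 1 p.79 – Thm 8 p.101, Prop. 5 p.94, (1.3)–(1.5) p.77, Prop. 6 p.99, Prop. 7 (1.145) p.100; Balaban1985BackgroundPropagators, Thm 3.1 p.397, Thms 3.2–3.3 p.399, Thm 3.11, (3.45)–(3.47); Balaban1989LargeFieldII, Thm 1 p.355, (0.1) pp.355–356, (0.15) p.360; Balaban1988Convergent, Theorem p.245, Cor. 3 (2.50) p.264, (1.15) p.249, (3.16)–(3.25) pp.268–270; Balaban1987RG1, (0.14)–(0.17) pp.254–255, (0.20) p.256, Thm 3 p.264, §1 pp.263–264; Balaban1988RG2Cluster, Lemmas 1–3 pp.9–20 (bookkeeping)] -/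
theorem N24_stabilityBRunRowsAtRecordR13SepCoPHV_byName_of_openStubsGridG_of_n06TorusDataLettersLSlot8KappaPrime_stage3DoorFree_n13LevelZero_atGaussPinPrintedZ_pinYP_of_runRowsCont (M₁ R : ℕ) (hM₁ : 1 ≤ M₁) (ε : ℝ) (hεz : 0 < ε)
    (Efl : T4Family → ℕ → ℝ → ℝ → ℝ → ℝ → ℝ → ℝ → ℝ → B12.RunParams → ℕ → ℝ)
    (h1G3 : ∀ F : T4Family, ∃ (c c₀ c₁ : ℕ) (B₃ a₀ a₁ : ℝ), 2 * (F.L : ℝ) ^ 2 ≤ B₃ ∧ 0 < a₀ ∧ 0 < a₁ ∧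
      Prop8RegSepTopStepG F 2 (fun ν K Ω => suppDomOfRecord F ν K Ω) (fun ν M g K k _s => c ≤ ν.M₁ ∧ k + c₀ ≤ F.m + K ∧ F.L ^ c₁ ∣ M ∧
      ∀ i, 1 ≤ i → i ≤ k → dCubeSide (F.P K).L M (RkOfRecord (F.P K).L ν.r (g i)) i ∣ (F.P K).sitesPerDir 0) B₃ a₀ a₁)
    (h3A'G3 : ∀ F : T4Family, ∀ (j c c₀ c₁ : ℕ) (B₃ B₃' a₀ a₁ : ℝ), c ≤ F.L ^ j → c₀ ≤ j + 1 → c₁ ≤ j → 2 * (F.L : ℝ) ^ 2 ≤ B₃ → 0 < B₃' → 0 < a₀ → 0 < a₁ →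
      VariationalThm1RegSepCoP7MG F 2 (fun ν M g K k _s => c ≤ ν.M₁ ∧ k + c₀ ≤ F.m + K ∧ F.L ^ c₁ ∣ M ∧
      ∀ i, 1 ≤ i → i ≤ k → dCubeSide (F.P K).L M (RkOfRecord (F.P K).L ν.r (g i)) i ∣ (F.P K).sitesPerDir 0) B₃ a₀ a₁ →
      Gauge9RegSepTopStepG F 2 (fun ν K Ω => suppDomOfRecord F ν K Ω) (F.L ^ j) (fun ν M g K k _s => c ≤ ν.M₁ ∧ k + c₀ ≤ F.m + K ∧ F.L ^ c₁ ∣ M ∧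
      ∀ i, 1 ≤ i → i ≤ k → dCubeSide (F.P K).L M (RkOfRecord (F.P K).L ν.r (g i)) i ∣ (F.P K).sitesPerDir 0) B₃ B₃' a₀ a₁ →
      ∃ γ₀ ε₀ ε₂₉ β' : ℝ, 0 < γ₀ ∧ 0 < ε₀ ∧ 0 < ε₂₉ ∧
        BetaLowerH (-β') γ₀ (betaOfRecord₁₃ F 2 (theta13OfThm1CCM F 2 j ε₀ ε₂₉ B₃ B₃' a₀ a₁)) ∧
        BetaUpperH β' γ₀ (betaOfRecord₁₃ F 2 (theta13OfThm1CCM F 2 j ε₀ ε₂₉ B₃ B₃' a₀ a₁)))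
    (hN06 : ∀ (F : T4Family) [FiniteDimensional ℝ (stage3OfFamily F).𝔸],
      ∃ (τ : (stage3OfFamily F).𝔸 →ₗ[ℂ] ℂ) (Cτ β : ℝ) (len : B7Prop1Explicit.Site (stage3OfFamily F).D → ℝ) (B₀'H B₂' BG BR cL : ℝ),
        (∀ a : (stage3OfFamily F).𝔸, a ≠ 0 → 0 < (τ (star a * a)).re) ∧ (∀ a b : (stage3OfFamily F).𝔸, τ (a * b) = τ (b * a)) ∧
        (∀ a : (stage3OfFamily F).𝔸, τ (star a) = starRingEnd ℂ (τ a)) ∧ (∀ x y : (stage3OfFamily F).𝔸, |(τ (star x * y)).re| ≤ Cτ * ‖x‖ * ‖y‖) ∧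
        0 ≤ β ∧ (∀ v : B7Prop1Explicit.Site (stage3OfFamily F).D, 0 < len v → 1 ≤ len v) ∧
        0 < B₀'H ∧ 0 ≤ B₂' ∧ 0 ≤ BG ∧ 0 ≤ BR ∧ 0 < cL ∧
        (∀ a : IdxB8SubDPerκ (stage3OfFamily F) (M₁ * (stage3OfFamily F).L) M₁ R, ∀ α₀ : ℝ, 0 < α₀ → α₀ ≤ cL → ∀ U₀ : B7Prop1Explicit.Site (stage3OfFamily F).D → Fin (stage3OfFamily F).D → (stage3OfFamily F).𝔸ˣ, (∀ x κ, U₀ x κ ∈ unitaryUnits (stage3OfFamily F).𝔸) → IsPeriodic (M₁ * (stage3OfFamily F).L) U₀ →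
      InAk (stage3OfFamily F).L a.toZdIdx.k a.toZdIdx.η α₀ a.toZdIdx.Ω U₀ → ∀ n, 1 ≤ n → n ≤ a.toZdIdx.k →
      ∃ (g Δ : (B7Prop1Explicit.Site (stage3OfFamily F).D → (stage3OfFamily F).𝔸) →ₗ[ℂ] (B7Prop1Explicit.Site (stage3OfFamily F).D → (stage3OfFamily F).𝔸)) (q : (B7Prop1Explicit.Site (stage3OfFamily F).D → (stage3OfFamily F).𝔸) →ₗ[ℂ] (ℕ → B7Prop1Explicit.Site (stage3OfFamily F).D → (stage3OfFamily F).𝔸)) (qs : (ℕ → B7Prop1Explicit.Site (stage3OfFamily F).D → (stage3OfFamily F).𝔸) →ₗ[ℂ] (B7Prop1Explicit.Site (stage3OfFamily F).D → (stage3OfFamily F).𝔸))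
        (Aw c : (ℕ → B7Prop1Explicit.Site (stage3OfFamily F).D → (stage3OfFamily F).𝔸) →ₗ[ℂ] (ℕ → B7Prop1Explicit.Site (stage3OfFamily F).D → (stage3OfFamily F).𝔸)) (H' : XSpace (stage3OfFamily F).D n (stage3OfFamily F).𝔸 →ₗ[ℂ] (B7Prop1Explicit.Site (stage3OfFamily F).D → (stage3OfFamily F).𝔸)),
        (∀ x, (∀ (z : B7Prop1Explicit.Site (stage3OfFamily F).D) (i : Fin (stage3OfFamily F).D), x (z + ((M₁ * (stage3OfFamily F).L) : ℤ) • B7Prop1Explicit.e i) = x z) → ∀ y ∈ a.toZdIdx.Ω 0, (Δ (g x) + qs (Aw (q (g x)))) y = x y) ∧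
        (∀ f, (∀ (z : B7Prop1Explicit.Site (stage3OfFamily F).D) (i : Fin (stage3OfFamily F).D), f (z + ((M₁ * (stage3OfFamily F).L) : ℤ) • B7Prop1Explicit.e i) = f z) → q (g (g (qs (c (q f))))) = q f) ∧
        (∀ (f : B7Prop1Explicit.Site (stage3OfFamily F).D → (stage3OfFamily F).𝔸) (z : B7Prop1Explicit.Site (stage3OfFamily F).D) (i : Fin (stage3OfFamily F).D), g f (z + ((M₁ * (stage3OfFamily F).L) : ℤ) • B7Prop1Explicit.e i) = g f z) ∧
        (∀ f : B7Prop1Explicit.Site (stage3OfFamily F).D → (stage3OfFamily F).𝔸, (∀ (z : B7Prop1Explicit.Site (stage3OfFamily F).D) (i : Fin (stage3OfFamily F).D), f (z + ((M₁ * (stage3OfFamily F).L) : ℤ) • B7Prop1Explicit.e i) = f z) →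
      ∀ (z : B7Prop1Explicit.Site (stage3OfFamily F).D) (i : Fin (stage3OfFamily F).D), qs (c (q f)) (z + ((M₁ * (stage3OfFamily F).L) : ℤ) • B7Prop1Explicit.e i) = qs (c (q f)) z) ∧
        (∀ (f : B7Prop1Explicit.Site (stage3OfFamily F).D → (stage3OfFamily F).𝔸), ∀ x ∈ a.toZdIdx.Ω 0, Δ f x = covLap a.toZdIdx.η U₀ ((a.toZdIdx.Ω 0).indicator f) x) ∧
        (∀ (μ : ℕ → B7Prop1Explicit.Site (stage3OfFamily F).D → (stage3OfFamily F).𝔸), ∀ x ∈ a.toZdIdx.Ω 0, qs μ x = QT (stage3OfFamily F).L n (a.toZdIdx.Λs n) U₀ μ x) ∧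
        (∀ (f : B7Prop1Explicit.Site (stage3OfFamily F).D → (stage3OfFamily F).𝔸) (j : ℕ), j ≤ n → ∀ y ∈ a.toZdIdx.Λs n j, q f j y = QprimeIter (zdBlocking (stage3OfFamily F).D (stage3OfFamily F).L) (bgT (stage3OfFamily F).L U₀) j f y) ∧
        (∀ (X : XSpace (stage3OfFamily F).D n (stage3OfFamily F).𝔸) (x : B7Prop1Explicit.Site (stage3OfFamily F).D), ‖H' X x‖ ≤ B₀'H * ‖X‖) ∧
        (∀ j, j ≤ n → ∀ (X : XSpace (stage3OfFamily F).D n (stage3OfFamily F).𝔸), ∀ b ∈ {b : B7Prop1Explicit.Site (stage3OfFamily F).D × Fin (stage3OfFamily F).D | SideTouches (a.toZdIdx.Ω j) b.1 b.2},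
      wt (stage3OfFamily F).L a.toZdIdx.η j * ‖covDerivFwd a.toZdIdx.η U₀ b.2 (H' X) b.1‖ ≤ B₀'H * ‖X‖) ∧
        (∀ X : XSpace (stage3OfFamily F).D n (stage3OfFamily F).𝔸, Bd2 (stage3OfFamily F).L a.toZdIdx.η n a.toZdIdx.Ω (covLap a.toZdIdx.η U₀ (H' X)) (B₂' * ‖X‖)) ∧
        (∀ (X : XSpace (stage3OfFamily F).D n (stage3OfFamily F).𝔸) (x : B7Prop1Explicit.Site (stage3OfFamily F).D), x ∉ a.toZdIdx.Ω 0 → H' X x = 0) ∧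
        (∀ X Y : XSpace (stage3OfFamily F).D n (stage3OfFamily F).𝔸, (∀ b, Y b = -star (X b)) → ∀ x, H' Y x = -star (H' X x)) ∧
        (∀ X : XSpace (stage3OfFamily F).D n (stage3OfFamily F).𝔸, (∀ (b : Fin (n + 1) × B7Prop1Explicit.Site (stage3OfFamily F).D) (i : Fin (stage3OfFamily F).D), X (b.1, b.2 + (((M₁ * (stage3OfFamily F).L) : ℤ) / ((stage3OfFamily F).L : ℤ) ^ (b.1 : ℕ)) • B7Prop1Explicit.e i) = X b) →
      ∀ (z : B7Prop1Explicit.Site (stage3OfFamily F).D) (i : Fin (stage3OfFamily F).D), H' X (z + ((M₁ * (stage3OfFamily F).L) : ℤ) • B7Prop1Explicit.e i) = H' X z) ∧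
        (∀ (Y : XSpace (stage3OfFamily F).D n (stage3OfFamily F).𝔸), (∀ (b : Fin (n + 1) × B7Prop1Explicit.Site (stage3OfFamily F).D) (i : Fin (stage3OfFamily F).D), Y (b.1, b.2 + (((M₁ * (stage3OfFamily F).L) : ℤ) / ((stage3OfFamily F).L : ℤ) ^ (b.1 : ℕ)) • B7Prop1Explicit.e i) = Y b) →
      ∀ (j : ℕ) (hj : j ≤ n) (y : B7Prop1Explicit.Site (stage3OfFamily F).D), y ∈ a.toZdIdx.Λs n j →
      QprimeIter (zdBlocking (stage3OfFamily F).D (stage3OfFamily F).L) (bgT (stage3OfFamily F).L U₀) j (H' Y) y = Y (⟨j, Nat.lt_succ_of_le hj⟩, y)) ∧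
        (∀ (f : B7Prop1Explicit.Site (stage3OfFamily F).D → (stage3OfFamily F).𝔸) (r : ℝ), 0 ≤ r → Bd2 (stage3OfFamily F).L a.toZdIdx.η n a.toZdIdx.Ω f r →
      (∀ x, ‖g f x‖ ≤ BG * r) ∧ ∀ j, j ≤ n → ∀ b ∈ {b : B7Prop1Explicit.Site (stage3OfFamily F).D × Fin (stage3OfFamily F).D | SideTouches (a.toZdIdx.Ω j) b.1 b.2},
        wt (stage3OfFamily F).L a.toZdIdx.η j * ‖covDerivFwd a.toZdIdx.η U₀ b.2 (g f) b.1‖ ≤ BG * r) ∧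
        (∀ (f : B7Prop1Explicit.Site (stage3OfFamily F).D → (stage3OfFamily F).𝔸) (x : B7Prop1Explicit.Site (stage3OfFamily F).D), x ∉ a.toZdIdx.Ω 0 → g f x = 0) ∧
        (∀ f : B7Prop1Explicit.Site (stage3OfFamily F).D → (stage3OfFamily F).𝔸, (∀ j, j ≤ n → ∀ x ∈ a.toZdIdx.Ω j, IsSelfAdjoint (f x)) → ∀ x, IsSelfAdjoint (g f x)) ∧
        (∀ (f : B7Prop1Explicit.Site (stage3OfFamily F).D → (stage3OfFamily F).𝔸) (r : ℝ), 0 ≤ r → Bd2 (stage3OfFamily F).L a.toZdIdx.η n a.toZdIdx.Ω f r → Bd2 (stage3OfFamily F).L a.toZdIdx.η n a.toZdIdx.Ω (f - g (qs (c (q (g f))))) (BR * r)) ∧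
        (∀ f : B7Prop1Explicit.Site (stage3OfFamily F).D → (stage3OfFamily F).𝔸, (∀ j, j ≤ n → ∀ x ∈ a.toZdIdx.Ω j, IsSelfAdjoint (f x)) →
      ∀ j, j ≤ n → ∀ x ∈ a.toZdIdx.Ω j, IsSelfAdjoint ((f - g (qs (c (q (g f))))) x))) ∧
        (∀ a : IdxB8LanCκPer (stage3OfFamily F) (M₁ * (stage3OfFamily F).L) M₁ R, ∀ α₀ : ℝ, 0 < α₀ → α₀ ≤ cL → InAk (stage3OfFamily F).L a.toZdLanIdx.k a.toZdLanIdx.η α₀ a.toZdLanIdx.Ω a.toZdLanIdx.U₀ →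
      ∃ (g Δ : (B7Prop1Explicit.Site (stage3OfFamily F).D → (stage3OfFamily F).𝔸) →ₗ[ℂ] (B7Prop1Explicit.Site (stage3OfFamily F).D → (stage3OfFamily F).𝔸)) (q : (B7Prop1Explicit.Site (stage3OfFamily F).D → (stage3OfFamily F).𝔸) →ₗ[ℂ] (ℕ → B7Prop1Explicit.Site (stage3OfFamily F).D → (stage3OfFamily F).𝔸)) (qs : (ℕ → B7Prop1Explicit.Site (stage3OfFamily F).D → (stage3OfFamily F).𝔸) →ₗ[ℂ] (B7Prop1Explicit.Site (stage3OfFamily F).D → (stage3OfFamily F).𝔸))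
        (Aw c : (ℕ → B7Prop1Explicit.Site (stage3OfFamily F).D → (stage3OfFamily F).𝔸) →ₗ[ℂ] (ℕ → B7Prop1Explicit.Site (stage3OfFamily F).D → (stage3OfFamily F).𝔸)) (H' : XSpace (stage3OfFamily F).D a.toZdLanIdx.k (stage3OfFamily F).𝔸 →ₗ[ℂ] (B7Prop1Explicit.Site (stage3OfFamily F).D → (stage3OfFamily F).𝔸)),
        (∀ x : B7Prop1Explicit.Site (stage3OfFamily F).D → (stage3OfFamily F).𝔸, (∀ (z : B7Prop1Explicit.Site (stage3OfFamily F).D) (i : Fin (stage3OfFamily F).D), x (z + ((M₁ * (stage3OfFamily F).L) : ℤ) • B7Prop1Explicit.e i) = x z) → (∃ C : ℝ, ∀ y, ‖x y‖ ≤ C) →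
          g (Δ x + qs (Aw (q x))) = x) ∧
        (∀ φ : ℕ → B7Prop1Explicit.Site (stage3OfFamily F).D → (stage3OfFamily F).𝔸, (∀ n, n ≤ a.toZdLanIdx.k → ∀ (y : B7Prop1Explicit.Site (stage3OfFamily F).D) (i : Fin (stage3OfFamily F).D), φ n (y + (((M₁ * (stage3OfFamily F).L) : ℤ) / ((stage3OfFamily F).L : ℤ) ^ n) • B7Prop1Explicit.e i) = φ n y) →
          qs (c (q (g (g (qs φ))))) = qs φ) ∧
        (∀ (f : B7Prop1Explicit.Site (stage3OfFamily F).D → (stage3OfFamily F).𝔸), ∀ x ∈ a.toZdLanIdx.Ω 0, Δ f x = covLap a.toZdLanIdx.η a.toZdLanIdx.U₀ ((a.toZdLanIdx.Ω 0).indicator f) x) ∧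
        (∀ (μ : ℕ → B7Prop1Explicit.Site (stage3OfFamily F).D → (stage3OfFamily F).𝔸), ∀ x ∈ a.toZdLanIdx.Ω 0, qs μ x = QT (stage3OfFamily F).L a.toZdLanIdx.k a.toZdLanIdx.Λ a.toZdLanIdx.U₀ μ x) ∧
        (∀ (f : B7Prop1Explicit.Site (stage3OfFamily F).D → (stage3OfFamily F).𝔸) (n : ℕ), n ≤ a.toZdLanIdx.k → ∀ y ∈ a.toZdLanIdx.Λ n, q f n y = QprimeIter (zdBlocking (stage3OfFamily F).D (stage3OfFamily F).L) (bgT (stage3OfFamily F).L a.toZdLanIdx.U₀) n f y) ∧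
        (∀ (f : B7Prop1Explicit.Site (stage3OfFamily F).D → (stage3OfFamily F).𝔸) (n : ℕ) (y : B7Prop1Explicit.Site (stage3OfFamily F).D), ¬ (n ≤ a.toZdLanIdx.k ∧ y ∈ a.toZdLanIdx.Λ n) → q f n y = 0) ∧
        (∀ (f : B7Prop1Explicit.Site (stage3OfFamily F).D → (stage3OfFamily F).𝔸) (z : B7Prop1Explicit.Site (stage3OfFamily F).D) (i : Fin (stage3OfFamily F).D), g f (z + ((M₁ * (stage3OfFamily F).L) : ℤ) • B7Prop1Explicit.e i) = g f z) ∧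
        (∀ μ : ℕ → B7Prop1Explicit.Site (stage3OfFamily F).D → (stage3OfFamily F).𝔸, ∀ n, n ≤ a.toZdLanIdx.k → ∀ (y : B7Prop1Explicit.Site (stage3OfFamily F).D) (i : Fin (stage3OfFamily F).D), Aw μ n (y + (((M₁ * (stage3OfFamily F).L) : ℤ) / ((stage3OfFamily F).L : ℤ) ^ n) • B7Prop1Explicit.e i) = Aw μ n y) ∧
        (∀ (X : XSpace (stage3OfFamily F).D a.toZdLanIdx.k (stage3OfFamily F).𝔸) (x : B7Prop1Explicit.Site (stage3OfFamily F).D), ‖H' X x‖ ≤ B₀'H * ‖X‖) ∧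
        (∀ n, n ≤ a.toZdLanIdx.k → ∀ (X : XSpace (stage3OfFamily F).D a.toZdLanIdx.k (stage3OfFamily F).𝔸), ∀ b ∈ {b : B7Prop1Explicit.Site (stage3OfFamily F).D × Fin (stage3OfFamily F).D | SideTouches (a.toZdLanIdx.Ω n) b.1 b.2},
          wt (stage3OfFamily F).L a.toZdLanIdx.η n * ‖covDerivFwd a.toZdLanIdx.η a.toZdLanIdx.U₀ b.2 (H' X) b.1‖ ≤ B₀'H * ‖X‖) ∧
        (∀ X : XSpace (stage3OfFamily F).D a.toZdLanIdx.k (stage3OfFamily F).𝔸, Bd2 (stage3OfFamily F).L a.toZdLanIdx.η a.toZdLanIdx.k a.toZdLanIdx.Ω (covLap a.toZdLanIdx.η a.toZdLanIdx.U₀ (H' X)) (B₂' * ‖X‖)) ∧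
        (∀ X : XSpace (stage3OfFamily F).D a.toZdLanIdx.k (stage3OfFamily F).𝔸, (∀ (q : Fin (a.toZdLanIdx.k + 1) × B7Prop1Explicit.Site (stage3OfFamily F).D) (i : Fin (stage3OfFamily F).D), X (q.1, q.2 + (((M₁ * (stage3OfFamily F).L) : ℤ) / ((stage3OfFamily F).L : ℤ) ^ (q.1 : ℕ)) • B7Prop1Explicit.e i) = X q) →
          ∀ (z : B7Prop1Explicit.Site (stage3OfFamily F).D) (i : Fin (stage3OfFamily F).D), H' X (z + ((M₁ * (stage3OfFamily F).L) : ℤ) • B7Prop1Explicit.e i) = H' X z) ∧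
        (∀ (Y : XSpace (stage3OfFamily F).D a.toZdLanIdx.k (stage3OfFamily F).𝔸), (∀ (q : Fin (a.toZdLanIdx.k + 1) × B7Prop1Explicit.Site (stage3OfFamily F).D) (i : Fin (stage3OfFamily F).D), Y (q.1, q.2 + (((M₁ * (stage3OfFamily F).L) : ℤ) / ((stage3OfFamily F).L : ℤ) ^ (q.1 : ℕ)) • B7Prop1Explicit.e i) = Y q) →
          ∀ (n : ℕ) (hn : n ≤ a.toZdLanIdx.k) (y : B7Prop1Explicit.Site (stage3OfFamily F).D), y ∈ a.toZdLanIdx.Λ n →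
          QprimeIter (zdBlocking (stage3OfFamily F).D (stage3OfFamily F).L) (bgT (stage3OfFamily F).L a.toZdLanIdx.U₀) n (H' Y) y = Y (⟨n, Nat.lt_succ_of_le hn⟩, y)) ∧
        (∀ (f : B7Prop1Explicit.Site (stage3OfFamily F).D → (stage3OfFamily F).𝔸) (r : ℝ), 0 ≤ r → Bd2 (stage3OfFamily F).L a.toZdLanIdx.η a.toZdLanIdx.k a.toZdLanIdx.Ω f r →
          (∀ x, ‖g f x‖ ≤ BG * r) ∧ ∀ n, n ≤ a.toZdLanIdx.k → ∀ b ∈ {b : B7Prop1Explicit.Site (stage3OfFamily F).D × Fin (stage3OfFamily F).D | SideTouches (a.toZdLanIdx.Ω n) b.1 b.2},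
            wt (stage3OfFamily F).L a.toZdLanIdx.η n * ‖covDerivFwd a.toZdLanIdx.η a.toZdLanIdx.U₀ b.2 (g f) b.1‖ ≤ BG * r) ∧
        (∀ (f : B7Prop1Explicit.Site (stage3OfFamily F).D → (stage3OfFamily F).𝔸) (r : ℝ), 0 ≤ r → Bd2 (stage3OfFamily F).L a.toZdLanIdx.η a.toZdLanIdx.k a.toZdLanIdx.Ω f r →
          Bd2 (stage3OfFamily F).L a.toZdLanIdx.η a.toZdLanIdx.k a.toZdLanIdx.Ω (f - g (qs (c (q (g f))))) (BR * r))))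
    (h06 : ∀ F : T4Family, ∃ (Mstar : ℕ) (ops : OpsY 2 (stage3OfFamily F) Mstar), B9LeafX (Y9OfRecordP 2 (stage3OfFamily F) Mstar ops))
    (h07 : ∀ F : T4Family, ∃ ζ : ResidZ F 2, B11Leaf (Z11OfRecord F 2 ζ))
    (h08 : ∀ F : T4Family, PrintedUV3V 2 F.L)
    (h09 : ∀ (F : T4Family) {j : ℕ} {γ ε₀ ε₂₉ B₃ B₃' a₀ a₁ : ℝ} (hγ₀ : 0 < γ) (hγh : γ ≤ 1 / 2) (hε : 0 < ε₀) (hε' : 0 < ε₂₉) (hB : 0 ≤ B₃) (hB' : 0 ≤ B₃') (ha₀ : 0 < a₀) (ha₁ : 0 < a₁) {bl β' : ℝ} (hbox : BetaLowerH bl γ (betaOfRecord₁₃ F 2 (theta13OfThm1CCMWZ F 2 j γ ε₀ ε₂₉ B₃ B₃' a₀ a₁ (Efl F j γ ε₀ ε₂₉ B₃ B₃' a₀ a₁) (fun p i => Real.log (B16ZLower.zNorm (SU 2) (gOfRecord₁₃ F 2 (theta13OfThm1CCMW F 2 j γ ε₀ ε₂₉ B₃ B₃' a₀ a₁) p i ^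 2) ε))))) (hbox' : BetaUpperH β' γ (betaOfRecord₁₃ F 2 (theta13OfThm1CCMWZ F 2 j γ ε₀ ε₂₉ B₃ B₃' a₀ a₁ (Efl F j γ ε₀ ε₂₉ B₃ B₃' a₀ a₁) (fun p i => Real.log (B16ZLower.zNorm (SU 2) (gOfRecord₁₃ F 2 (theta13OfThm1CCMW F 2 j γ ε₀ ε₂₉ B₃ B₃' a₀ a₁) p i ^ 2) ε))))) (hl : -bl * γ ^ 2 ≤ 3) (hβ' : β' * γ ^ 2 ≤ 3 / 4),
      ∃ lam12 : ResidB12 F 2 (theta13OfThm1CCMWZ F 2 j γ ε₀ ε₂₉ B₃ B₃' a₀ a₁ (Efl F j γ ε₀ ε₂₉ B₃ B₃' a₀ a₁) (fun p i => Real.log (B16ZLower.zNorm (SU 2) (gOfRecord₁₃ F 2 (theta13OfThm1CCMW F 2 j γ ε₀ ε₂₉ B₃ B₃' a₀ a₁) p i ^ 2) ε))).τ9.M,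
      ∀ P : B12.RunParams, B12Sec2to5.Lemma4Printed (F12OfRecord₁₂ F 2 (theta13OfThm1CCMWZ F 2 j γ ε₀ ε₂₉ B₃ B₃' a₀ a₁ (Efl F j γ ε₀ ε₂₉ B₃ B₃' a₀ a₁) (fun p i => Real.log (B16ZLower.zNorm (SU 2) (gOfRecord₁₃ F 2 (theta13OfThm1CCMW F 2 j γ ε₀ ε₂₉ B₃ B₃' a₀ a₁) p i ^ 2) ε))).toStage12Params lam12 P) (lam12 P).consts)
    (h09T : ∀ (F : T4Family) {j : ℕ} {γ ε₀ ε₂₉ B₃ B₃' a₀ a₁ : ℝ} (hγ₀ : 0 < γ) (hγh : γ ≤ 1 / 2) (hε : 0 < ε₀) (hε' : 0 < ε₂₉) (hB : 0 ≤ B₃) (hB' : 0 ≤ B₃') (ha₀ : 0 < a₀) (ha₁ : 0 < a₁) {bl β' : ℝ} (hbox : BetaLowerH bl γ (betaOfRecord₁₃ F 2 (theta13OfThm1CCMWZ F 2 j γ ε₀ ε₂₉ B₃ B₃' a₀ a₁ (Efl F j γ ε₀ ε₂₉ B₃ B₃' a₀ a₁) (fun p i => Real.log (B16ZLower.zNorm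 (SU 2) (gOfRecord₁₃ F 2 (theta13OfThm1CCMW F 2 j γ ε₀ ε₂₉ B₃ B₃' a₀ a₁) p i ^ 2) ε))))) (hbox' : BetaUpperH β' γ (betaOfRecord₁₃ F 2 (theta13OfThm1CCMWZ F 2 j γ ε₀ ε₂₉ B₃ B₃' a₀ a₁ (Efl F j γ ε₀ ε₂₉ B₃ B₃' a₀ a₁) (fun p i => Real.log (B16ZLower.zNorm (SU 2) (gOfRecord₁₃ F 2 (theta13OfThm1CCMW F 2 j γ ε₀ ε₂₉ B₃ B₃' a₀ a₁) p i ^ 2) ε))))) (hl : -bl * γ ^ 2 ≤ 3) (hβ' : β' * γ ^ 2 ≤ 3 / 4)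
      (hP : (gaussPinH (Stage13HParams.ofHistoryBlind F 2 ⟨theta13OfThm1CCMWZ F 2 j γ ε₀ ε₂₉ B₃ B₃' a₀ a₁ (Efl F j γ ε₀ ε₂₉ B₃ B₃' a₀ a₁) (fun p i => Real.log (B16ZLower.zNorm (SU 2) (gOfRecord₁₃ F 2 (theta13OfThm1CCMW F 2 j γ ε₀ ε₂₉ B₃ B₃' a₀ a₁) p i ^ 2) ε)), ZrOfRecord₁₃ F 2 (theta13OfThm1CCMWZ F 2 j γ ε₀ ε₂₉ B₃ B₃' a₀ a₁ (Efl F j γ ε₀ ε₂₉ B₃ B₃' a₀ a₁) (fun p i => Real.log (B16ZLower.zNorm (SU 2) (gOfRecord₁₃ F 2 (theta13OfThm1CCMW F 2 j γ ε₀ ε₂₉ B₃ B₃' a₀ a₁) p i ^ 2) ε)))⟩)).Provisos₁₃SepCoPH F 2),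
      ∃ γ₉ : ℝ, 0 < γ₉ ∧ ∀ w : WorldP, w.C = (datumOfRecord₁₃SepCoPH F 2 (gaussPinH (Stage13HParams.ofHistoryBlind F 2 ⟨theta13OfThm1CCMWZ F 2 j γ ε₀ ε₂₉ B₃ B₃' a₀ a₁ (Efl F j γ ε₀ ε₂₉ B₃ B₃' a₀ a₁) (fun p i => Real.log (B16ZLower.zNorm (SU 2) (gOfRecord₁₃ F 2 (theta13OfThm1CCMW F 2 j γ ε₀ ε₂₉ B₃ B₃' a₀ a₁) p i ^ 2) ε)), ZrOfRecord₁₃ F 2 (theta13OfThm1CCMWZ F 2 j γ ε₀ ε₂₉ B₃ B₃' a₀ a₁ (Efl F j γ ε₀ ε₂₉ B₃ B₃' a₀ a₁) (fun p i => Real.log (B16ZLower.zNorm (SU 2) (gOfRecord₁₃ F 2 (theta13OfThm1CCMW F 2 j γ ε₀ ε₂₉ B₃ B₃' a₀ a₁) p i ^ 2) ε)))⟩)) hP).C →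
      w.γ ≤ γ₉ → ∀ P : B12.RunParams, (leavesP w P).smallCouplings → (leavesP w P).smallFieldInductive)
    (h10 : ∀ F : T4Family, ∃ lam13 : B12.RunParams → ResidB13 (stage3OfFamily F), ∀ P : B12.RunParams, B13LeafOfRecord (stage3OfFamily F) (lam13 P))
    (h11N : ∀ (F : T4Family) {j : ℕ} {γ ε₀ ε₂₉ B₃ B₃' a₀ a₁ : ℝ} (hγ₀ : 0 < γ) (hγh : γ ≤ 1 / 2) (hε : 0 < ε₀) (hε' : 0 < ε₂₉) (hB : 0 ≤ B₃) (hB' : 0 ≤ B₃') (ha₀ : 0 < a₀) (ha₁ : 0 < a₁) {bl β' : ℝ} (hbox : BetaLowerH bl γ (betaOfRecord₁₃ F 2 (theta13OfThm1CCMWZ F 2 j γ ε₀ ε₂₉ B₃ B₃' a₀ a₁ (Efl F j γ ε₀ ε₂₉ B₃ B₃' a₀ a₁) (fun p i => Real.log (B16ZLower.zNorm (SU 2) (gOfRecord₁₃ F 2 (theta13OfThm1CCMW F 2 j γ ε₀ ε₂₉ B₃ B₃' a₀ a₁) p i ^ 2) ε))))) (hbox' : BetaUpperH β' γ (betaOfRecord₁₃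 F 2 (theta13OfThm1CCMWZ F 2 j γ ε₀ ε₂₉ B₃ B₃' a₀ a₁ (Efl F j γ ε₀ ε₂₉ B₃ B₃' a₀ a₁) (fun p i => Real.log (B16ZLower.zNorm (SU 2) (gOfRecord₁₃ F 2 (theta13OfThm1CCMW F 2 j γ ε₀ ε₂₉ B₃ B₃' a₀ a₁) p i ^ 2) ε))))) (hl : -bl * γ ^ 2 ≤ 3) (hβ' : β' * γ ^ 2 ≤ 3 / 4),
      ∃ σ : (P : B12.RunParams) → Sect3Supplier (gaussPinH (Stage13HParams.ofHistoryBlind F 2 ⟨theta13OfThm1CCMWZ F 2 j γ ε₀ ε₂₉ B₃ B₃' a₀ a₁ (Efl F j γ ε₀ ε₂₉ B₃ B₃' a₀ a₁) (fun p i => Real.log (B16ZLower.zNorm (SU 2) (gOfRecord₁₃ F 2 (theta13OfThm1CCMW F 2 j γ ε₀ ε₂₉ B₃ B₃' a₀ a₁) p i ^ 2) ε)), ZrOfRecord₁₃ F 2 (theta13OfThm1CCMWZ F 2 j γ ε₀ ε₂₉ B₃ B₃' a₀ a₁ (Efl F j γ ε₀ ε₂₉ B₃ B₃' a₀ a₁)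 (fun p i => Real.log (B16ZLower.zNorm (SU 2) (gOfRecord₁₃ F 2 (theta13OfThm1CCMW F 2 j γ ε₀ ε₂₉ B₃ B₃' a₀ a₁) p i ^ 2) ε)))⟩)) P,
        (∀ P : B12.RunParams, Step.InInterval γ P.K (gOfRecord₁₃ F 2 (theta13OfThm1CCMWZ F 2 j γ ε₀ ε₂₉ B₃ B₃' a₀ a₁ (Efl F j γ ε₀ ε₂₉ B₃ B₃' a₀ a₁) (fun p i => Real.log (B16ZLower.zNorm (SU 2) (gOfRecord₁₃ F 2 (theta13OfThm1CCMW F 2 j γ ε₀ ε₂₉ B₃ B₃' a₀ a₁) p i ^ 2) ε))) P) → SupplierObligations (gaussPinH (Stage13HParams.ofHistoryBlind F 2 ⟨theta13OfThm1CCMWZ F 2 j γ ε₀ ε₂₉ B₃ B₃' a₀ a₁ (Efl F j γ ε₀ ε₂₉ B₃ B₃' a₀ a₁) (fun p i => Real.log (B16ZLower.zNorm (SU 2) (gOfRecord₁₃ F 2 (theta13OfThm1CCMW F 2 j γ ε₀ ε₂₉ B₃ B₃' a₀ a₁) p i ^ 2) ε)), ZrOfRecord₁₃ F 2 (theta13OfThm1CCMWZ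 F 2 j γ ε₀ ε₂₉ B₃ B₃' a₀ a₁ (Efl F j γ ε₀ ε₂₉ B₃ B₃' a₀ a₁) (fun p i => Real.log (B16ZLower.zNorm (SU 2) (gOfRecord₁₃ F 2 (theta13OfThm1CCMW F 2 j γ ε₀ ε₂₉ B₃ B₃' a₀ a₁) p i ^ 2) ε)))⟩)) P (σ P)) ∧
        (∀ P : B12.RunParams, Step.InInterval γ P.K (gOfRecord₁₃ F 2 (theta13OfThm1CCMWZ F 2 j γ ε₀ ε₂₉ B₃ B₃' a₀ a₁ (Efl F j γ ε₀ ε₂₉ B₃ B₃' a₀ a₁) (fun p i => Real.log (B16ZLower.zNorm (SU 2) (gOfRecord₁₃ F 2 (theta13OfThm1CCMW F 2 j γ ε₀ ε₂₉ B₃ B₃' a₀ a₁) p i ^ 2) ε))) P) → OperandRowsAlongChain (gaussPinH (Stage13HParams.ofHistoryBlind F 2 ⟨theta13OfThm1CCMWZ F 2 j γ ε₀ ε₂₉ B₃ B₃' a₀ a₁ (Efl F j γ ε₀ ε₂₉ B₃ B₃' a₀ a₁) (fun p i => Real.log (B16ZLower.zNorm (SU 2) (gOfRecord₁₃ F 2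 (theta13OfThm1CCMW F 2 j γ ε₀ ε₂₉ B₃ B₃' a₀ a₁) p i ^ 2) ε)), ZrOfRecord₁₃ F 2 (theta13OfThm1CCMWZ F 2 j γ ε₀ ε₂₉ B₃ B₃' a₀ a₁ (Efl F j γ ε₀ ε₂₉ B₃ B₃' a₀ a₁) (fun p i => Real.log (B16ZLower.zNorm (SU 2) (gOfRecord₁₃ F 2 (theta13OfThm1CCMW F 2 j γ ε₀ ε₂₉ B₃ B₃' a₀ a₁) p i ^ 2) ε)))⟩)) P (σ P)))
    (hEfl : ∀ (F : T4Family) (j : ℕ) (γ ε₀ ε₂₉ B₃ B₃' a₀ a₁ : ℝ), ∃ CE : ℝ, 0 ≤ CE ∧ ∀ (P : B12.RunParams) (i : ℕ), i < P.K → |Efl F j γ ε₀ ε₂₉ B₃ B₃' a₀ a₁ P i| ≤ CE * sitesCard (F.P P.K) (i + 1))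
    (h13pos : ∀ (F : T4Family) {j : ℕ} {γ ε₀ ε₂₉ B₃ B₃' a₀ a₁ : ℝ} (hγ₀ : 0 < γ) (hγh : γ ≤ 1 / 2) (hε : 0 < ε₀) (hε' : 0 < ε₂₉) (hB : 0 ≤ B₃) (hB' : 0 ≤ B₃') (ha₀ : 0 < a₀) (ha₁ : 0 < a₁) {bl β' : ℝ} (hbox : BetaLowerH bl γ (betaOfRecord₁₃ F 2 (theta13OfThm1CCMWZ F 2 j γ ε₀ ε₂₉ B₃ B₃' a₀ a₁ (Efl F j γ ε₀ ε₂₉ B₃ B₃' a₀ a₁) (fun p i => Real.log (B16ZLower.zNorm (SU 2) (gOfRecord₁₃ F 2 (theta13OfThm1CCMW F 2 j γ ε₀ ε₂₉ B₃ B₃' a₀ a₁) p i ^ 2) ε))))) (hbox' : BetaUpperH β' γ (betaOfRecord₁₃ F 2 (theta13OfThm1CCMWZ F 2 j γ ε₀ ε₂₉ B₃ B₃' a₀ a₁ (Efl F j γ ε₀ ε₂₉ B₃ B₃' a₀ a₁) (fun p i => Real.log (B16ZLower.zNorm (SU 2) (gOfRecord₁₃ F 2 (theta13OfThm1CCMW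 F 2 j γ ε₀ ε₂₉ B₃ B₃' a₀ a₁) p i ^ 2) ε))))) (hl : -bl * γ ^ 2 ≤ 3) (hβ' : β' * γ ^ 2 ≤ 3 / 4)
      (hP : (gaussPinH (Stage13HParams.ofHistoryBlind F 2 ⟨theta13OfThm1CCMWZ F 2 j γ ε₀ ε₂₉ B₃ B₃' a₀ a₁ (Efl F j γ ε₀ ε₂₉ B₃ B₃' a₀ a₁) (fun p i => Real.log (B16ZLower.zNorm (SU 2) (gOfRecord₁₃ F 2 (theta13OfThm1CCMW F 2 j γ ε₀ ε₂₉ B₃ B₃' a₀ a₁) p i ^ 2) ε)), ZrOfRecord₁₃ F 2 (theta13OfThm1CCMWZ F 2 j γ ε₀ ε₂₉ B₃ B₃' a₀ a₁ (Efl F j γ ε₀ ε₂₉ B₃ B₃' a₀ a₁) (fun p i => Real.log (B16ZLower.zNorm (SU 2) (gOfRecord₁₃ F 2 (theta13OfThm1CCMW F 2 j γ ε₀ ε₂₉ B₃ B₃' a₀ a₁) p i ^ 2) ε)))⟩)).Provisos₁₃SepCoPH F 2),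
      ∃ γ₁₃ : ℝ, 0 < γ₁₃ ∧ ∃ em ep : ℝ → ℝ,
        (∀ P : B12.RunParams, ((datumOfRecord₁₃SepCoPH F 2 (gaussPinH (Stage13HParams.ofHistoryBlind F 2 ⟨theta13OfThm1CCMWZ F 2 j γ ε₀ ε₂₉ B₃ B₃' a₀ a₁ (Efl F j γ ε₀ ε₂₉ B₃ B₃' a₀ a₁) (fun p i => Real.log (B16ZLower.zNorm (SU 2) (gOfRecord₁₃ F 2 (theta13OfThm1CCMW F 2 j γ ε₀ ε₂₉ B₃ B₃' a₀ a₁) p i ^ 2) ε)), ZrOfRecord₁₃ F 2 (theta13OfThm1CCMWZ F 2 j γ ε₀ ε₂₉ B₃ B₃' a₀ a₁ (Efl F j γ ε₀ ε₂₉ B₃ B₃' a₀ a₁) (fun p i => Real.log (B16ZLower.zNorm (SU 2) (gOfRecord₁₃ F 2 (theta13OfThm1CCMW F 2 j γ ε₀ ε₂₉ B₃ B₃' a₀ a₁) p i ^ 2) ε)))⟩)) hP).C P).flow.InInterval γ₁₃ P.K → ∀ k, k + 1 ≤ P.K → SLaw₁₃CoPH F 2 (gaussPinH (Stage13HParams.ofHistoryBlind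 F 2 ⟨theta13OfThm1CCMWZ F 2 j γ ε₀ ε₂₉ B₃ B₃' a₀ a₁ (Efl F j γ ε₀ ε₂₉ B₃ B₃' a₀ a₁) (fun p i => Real.log (B16ZLower.zNorm (SU 2) (gOfRecord₁₃ F 2 (theta13OfThm1CCMW F 2 j γ ε₀ ε₂₉ B₃ B₃' a₀ a₁) p i ^ 2) ε)), ZrOfRecord₁₃ F 2 (theta13OfThm1CCMWZ F 2 j γ ε₀ ε₂₉ B₃ B₃' a₀ a₁ (Efl F j γ ε₀ ε₂₉ B₃ B₃' a₀ a₁) (fun p i => Real.log (B16ZLower.zNorm (SU 2) (gOfRecord₁₃ F 2 (theta13OfThm1CCMW F 2 j γ ε₀ ε₂₉ B₃ B₃' a₀ a₁) p i ^ 2) ε)))⟩)) P (k + 1) →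
      ∀ᵐ U ∂(fieldMeasure (F.P P.K) (k + 1) (SU 2)),
        chiβOfRecord₁₃ F 2 (theta13OfThm1CCMWZ F 2 j γ ε₀ ε₂₉ B₃ B₃' a₀ a₁ (Efl F j γ ε₀ ε₂₉ B₃ B₃' a₀ a₁) (fun p i => Real.log (B16ZLower.zNorm (SU 2) (gOfRecord₁₃ F 2 (theta13OfThm1CCMW F 2 j γ ε₀ ε₂₉ B₃ B₃' a₀ a₁) p i ^ 2) ε))) P.K (gOfRecord₁₃ F 2 (theta13OfThm1CCMWZ F 2 j γ ε₀ ε₂₉ B₃ B₃' a₀ a₁ (Efl F j γ ε₀ ε₂₉ B₃ B₃' a₀ a₁) (fun p i => Real.log (B16ZLower.zNorm (SU 2) (gOfRecord₁₃ F 2 (theta13OfThm1CCMW F 2 j γ ε₀ ε₂₉ B₃ B₃' a₀ a₁) p i ^ 2) ε))) P) (k + 1) U *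
              Real.exp (-(1 / (gOfRecord₁₃ F 2 (theta13OfThm1CCMWZ F 2 j γ ε₀ ε₂₉ B₃ B₃' a₀ a₁ (Efl F j γ ε₀ ε₂₉ B₃ B₃' a₀ a₁) (fun p i => Real.log (B16ZLower.zNorm (SU 2) (gOfRecord₁₃ F 2 (theta13OfThm1CCMW F 2 j γ ε₀ ε₂₉ B₃ B₃' a₀ a₁) p i ^ 2) ε))) P (k + 1)) ^ 2 * wilsonBGOfRecord F 2 (theta13OfThm1CCMWZ F 2 j γ ε₀ ε₂₉ B₃ B₃' a₀ a₁ (Efl F j γ ε₀ ε₂₉ B₃ B₃' a₀ a₁) (fun p i => Real.log (B16ZLower.zNorm (SU 2) (gOfRecord₁₃ F 2 (theta13OfThm1CCMW F 2 j γ ε₀ ε₂₉ B₃ B₃' a₀ a₁) p i ^ 2) ε))).εbg P (k + 1) U)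
                - em (gOfRecord₁₃ F 2 (theta13OfThm1CCMWZ F 2 j γ ε₀ ε₂₉ B₃ B₃' a₀ a₁ (Efl F j γ ε₀ ε₂₉ B₃ B₃' a₀ a₁) (fun p i => Real.log (B16ZLower.zNorm (SU 2) (gOfRecord₁₃ F 2 (theta13OfThm1CCMW F 2 j γ ε₀ ε₂₉ B₃ B₃' a₀ a₁) p i ^ 2) ε))) P (k + 1)) * (Fintype.card (Literature.MathematicalPhysics.QuantumFieldTheory.Balaban1983to89.Site (F.P P.K) (k + 1)) : ℝ)) ≤ densOfRecord₁₃ F 2 (theta13OfThm1CCMWZ F 2 j γ ε₀ ε₂₉ B₃ B₃' a₀ a₁ (Efl F j γ ε₀ ε₂₉ B₃ B₃' a₀ a₁) (fun p i => Real.log (B16ZLower.zNorm (SU 2) (gOfRecord₁₃ F 2 (theta13OfThm1CCMW F 2 j γ ε₀ ε₂₉ B₃ B₃' a₀ a₁) p i ^ 2) ε))) P (k + 1) U ∧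
          densOfRecord₁₃ F 2 (theta13OfThm1CCMWZ F 2 j γ ε₀ ε₂₉ B₃ B₃' a₀ a₁ (Efl F j γ ε₀ ε₂₉ B₃ B₃' a₀ a₁) (fun p i => Real.log (B16ZLower.zNorm (SU 2) (gOfRecord₁₃ F 2 (theta13OfThm1CCMW F 2 j γ ε₀ ε₂₉ B₃ B₃' a₀ a₁) p i ^ 2) ε))) P (k + 1) U ≤ Real.exp (ep (gOfRecord₁₃ F 2 (theta13OfThm1CCMWZ F 2 j γ ε₀ ε₂₉ B₃ B₃' a₀ a₁ (Efl F j γ ε₀ ε₂₉ B₃ B₃' a₀ a₁) (fun p i => Real.log (B16ZLower.zNorm (SU 2) (gOfRecord₁₃ F 2 (theta13OfThm1CCMW F 2 j γ ε₀ ε₂₉ B₃ B₃' a₀ a₁) p i ^ 2) ε))) P (k + 1)) * (Fintype.card (Literature.MathematicalPhysics.QuantumFieldTheory.Balaban1983to89.Site (F.P P.K) (k + 1)) : ℝ))))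
    (hrowsR : ∀ (F : T4Family) {j : ℕ} {γ ε₀ ε₂₉ B₃ B₃' a₀ a₁ : ℝ} (hγ₀ : 0 < γ) (hγh : γ ≤ 1 / 2) (hε : 0 < ε₀) (hε' : 0 < ε₂₉) (hB : 0 ≤ B₃) (hB' : 0 ≤ B₃') (ha₀ : 0 < a₀) (ha₁ : 0 < a₁) {bl β' : ℝ} (hbox : BetaLowerH bl γ (betaOfRecord₁₃ F 2 (theta13OfThm1CCMWZ F 2 j γ ε₀ ε₂₉ B₃ B₃' a₀ a₁ (Efl F j γ ε₀ ε₂₉ B₃ B₃' a₀ a₁) (fun p i => Real.log (B16ZLower.zNorm (SU 2) (gOfRecord₁₃ F 2 (theta13OfThm1CCMW F 2 j γ ε₀ ε₂₉ B₃ B₃' a₀ a₁) p i ^ 2) ε))))) (hbox' : BetaUpperH β' γ (betaOfRecord₁₃ F 2 (theta13OfThm1CCMWZ F 2 j γ ε₀ ε₂₉ B₃ B₃' a₀ a₁ (Efl F j γ ε₀ ε₂₉ B₃ B₃' a₀ a₁) (fun p i => Real.log (B16ZLower.zNorm (SU 2) (gOfRecord₁₃ F 2 (theta13OfThm1CCMW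 F 2 j γ ε₀ ε₂₉ B₃ B₃' a₀ a₁) p i ^ 2) ε))))) (hl : -bl * γ ^ 2 ≤ 3) (hβ' : β' * γ ^ 2 ≤ 3 / 4),
      ∃ (b : ℕ → ℝ) (r γ₀ M : ℝ), 0 < γ₀ ∧
        (∀ (n : ℕ) (gs : ℕ → ℝ), RGEqH n (betaOfRecord₁₃ F 2 (theta13OfThm1CCMWZ F 2 j γ ε₀ ε₂₉ B₃ B₃' a₀ a₁ (Efl F j γ ε₀ ε₂₉ B₃ B₃' a₀ a₁) (fun p i => Real.log (B16ZLower.zNorm (SU 2) (gOfRecord₁₃ F 2 (theta13OfThm1CCMW F 2 j γ ε₀ ε₂₉ B₃ B₃' a₀ a₁) p i ^ 2) ε)))) gs → Step.InInterval γ₀ n gs → ∀ k, k ≤ n → |betaOfRecord₁₃ F 2 (theta13OfThm1CCMWZ F 2 j γ ε₀ ε₂₉ B₃ B₃' a₀ a₁ (Efl F j γ ε₀ ε₂₉ B₃ B₃' a₀ a₁) (fun p i => Real.log (B16ZLower.zNorm (SU 2) (gOfRecord₁₃ F 2 (theta13OfThm1CCMW F 2 j γ ε₀ ε₂₉ B₃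 B₃' a₀ a₁) p i ^ 2) ε))) k (prefixOf gs k) - b k| ≤ r) ∧
        (∀ (n : ℕ) (gs : ℕ → ℝ), RGEqH n (betaOfRecord₁₃ F 2 (theta13OfThm1CCMWZ F 2 j γ ε₀ ε₂₉ B₃ B₃' a₀ a₁ (Efl F j γ ε₀ ε₂₉ B₃ B₃' a₀ a₁) (fun p i => Real.log (B16ZLower.zNorm (SU 2) (gOfRecord₁₃ F 2 (theta13OfThm1CCMW F 2 j γ ε₀ ε₂₉ B₃ B₃' a₀ a₁) p i ^ 2) ε)))) gs → Step.InInterval γ₀ n gs → ∀ k, k ≤ n → -M ≤ ∑ j ∈ Finset.Ico k n, betaOfRecord₁₃ F 2 (theta13OfThm1CCMWZ F 2 j γ ε₀ ε₂₉ B₃ B₃' a₀ a₁ (Efl F j γ ε₀ ε₂₉ B₃ B₃' a₀ a₁) (fun p i => Real.log (B16ZLower.zNorm (SU 2) (gOfRecord₁₃ F 2 (theta13OfThm1CCMW F 2 j γ ε₀ ε₂₉ B₃ B₃' a₀ a₁) p i ^ 2) ε))) j (prefixOf gs j)) ∧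
        ∀ k : ℕ, ContinuousOn (fun x : ℝ => betaOfRecord₁₃ F 2 (theta13OfThm1CCMWZ F 2 j γ ε₀ ε₂₉ B₃ B₃' a₀ a₁ (Efl F j γ ε₀ ε₂₉ B₃ B₃' a₀ a₁) (fun p i => Real.log (B16ZLower.zNorm (SU 2) (gOfRecord₁₃ F 2 (theta13OfThm1CCMW F 2 j γ ε₀ ε₂₉ B₃ B₃' a₀ a₁) p i ^ 2) ε))) k (clampPrefix (betaOfRecord₁₃ F 2 (theta13OfThm1CCMWZ F 2 j γ ε₀ ε₂₉ B₃ B₃' a₀ a₁ (Efl F j γ ε₀ ε₂₉ B₃ B₃' a₀ a₁) (fun p i => Real.log (B16ZLower.zNorm (SU 2) (gOfRecord₁₃ F 2 (theta13OfThm1CCMW F 2 j γ ε₀ ε₂₉ B₃ B₃' a₀ a₁) p i ^ 2) ε)))) γ₀ k x))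
          {x : ℝ | 0 < x ∧ x ≤ γ₀ ∧ ∀ j', j' ≤ k → 1 / γ₀ ^ 2 ≤ Y (betaOfRecord₁₃ F 2 (theta13OfThm1CCMWZ F 2 j γ ε₀ ε₂₉ B₃ B₃' a₀ a₁ (Efl F j γ ε₀ ε₂₉ B₃ B₃' a₀ a₁) (fun p i => Real.log (B16ZLower.zNorm (SU 2) (gOfRecord₁₃ F 2 (theta13OfThm1CCMW F 2 j γ ε₀ ε₂₉ B₃ B₃' a₀ a₁) p i ^ 2) ε)))) γ₀ j' x}) :
    Summit.QuantumFields.YangMills.Theses.BalabanUVNodes.StabilityBRunRowsAtRecordR13SepCoPHV := by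
  refine N24_stabilityBRunRowsAtRecordR13SepCoPHV_byName_of_openStubsGridG_of_childrenSplitSlot8N11OperandRowsThm1AEPos_atGaussPinPrintedZ_pinYP_of_runRowsCont
    (fun θ₃ lam8 => ∃ (P : ℕ) (c₁ : ℝ) (ρ₀ : ℕ) (ax : ∀ i : IdxB8SubDPer θ₃ P, (famB8OfRecordPer θ₃ (lam8.cutSubBP₅κPer P M₁ R c₁ ρ₀).β (lam8.cutSubBP₅κPer P M₁ R c₁ ρ₀).len P i).Cfg → (famB8OfRecordPer θ₃ (lam8.cutSubBP₅κPer P M₁ R c₁ ρ₀).β (lam8.cutSubBP₅κPer P M₁ R c₁ ρ₀).len P i).Pert → (famB8OfRecordPer θ₃ (lam8.cutSubBP₅κPer P M₁ R c₁ ρ₀).β (lam8.cutSubBP₅κPer P M₁ R c₁ ρ₀).len P i).Pert), (0 < P ∧ M₁ * θ₃.L ∣ P) ∧ 0 < c₁ ∧ 1 ≤ ρ₀ ∧ B8LeafOfRecordSubBP₂DPerκ θ₃ P M₁ R ⟨lam8.cutSubBP₅κPer P M₁ R c₁ ρ₀, ax⟩)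
    ε hεz Efl h1G3 h3A'G3 (fun F {j} {γ} {ε₀} {ε₂₉} {B₃} {B₃'} {a₀} {a₁} hγ₀ hγh hε hε' hB hB' ha₀ ha₁ {bl} {β'} hbox hbox' hl hβ' => ?_)
    (fun F {j} {γ} {ε₀} {ε₂₉} {B₃} {B₃'} {a₀} {a₁} _ _ _ _ _ _ _ _ {bl} {β'} _ _ _ _ => h06 F) h07 h08 h09 h09T (fun F {j} {γ} {ε₀} {ε₂₉} {B₃} {B₃'} {a₀} {a₁} _ _ _ _ _ _ _ _ {bl} {β'} _ _ _ _ => h10 F) h11N hEfl h13pos hrowsR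
  -- the Stage-3 view of the printed-z member IS the family dictionary (`rfl`); ζ-L's door at `stage3OfFamily F`
  haveI : FiniteDimensional ℝ (stage3OfFamily F).𝔸 :=
    -- RE-KEY-NEUTRAL (director-ym №262, FLAG №14 T0 (β)): the by-name lemma of `Node00/Record12NumericsFamilyFiniteDim` (p692370), any `(stage3OfFamily F).𝔸`.
    Literature.MathematicalPhysics.QuantumFieldTheory.Balaban1983to89.Node00.finiteDimensional_𝔸_stage3OfFamily F
  obtain ⟨τ, Cτ, β, len, B₀'H, B₂', BG, BR, cL, hτp, hτt, hτs, hCτ, hβ, hlen, hB₀'H, hB₂', hBG, hBR, hcL, hLet, SLetUB⟩ := hN06 F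
  -- dag-n06-b's theorem is UNIFORM in the base letters `ops₀` and the block parameter `M`: chosen here (`ops₀ := 0`, `M := 1`), off the display
  let ops₀ : ℝ → ZdIdx (stage3OfFamily F).D (stage3OfFamily F).L → ℕ → OpsZd (stage3OfFamily F).D (stage3OfFamily F).𝔸 :=
    fun _ _ _ => ⟨fun _ _ _ _ => 0, fun _ _ _ _ => 0, fun _ _ _ _ => 0, fun _ _ _ _ => 0⟩
  haveI : NeZero (M₁ * (stage3OfFamily F).L) := ⟨Nat.pos_iff_ne_zero.mp (Nat.mul_pos hM₁ (by have := F.hL11; show 0 < F.L; omega))⟩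
  -- N06's five binders with ONE constant set over all members, from dag-n06-b's η-free ∃∀ theorem (road (i): the η-scaling of the record)
  obtain ⟨aI, haI, aT, haT, B₀, hB₀, Cβ, hCβ, cS, hcS, cSβ, hcSβ, hB⟩ :=
    Literature.MathematicalPhysics.QuantumFieldTheory.Balaban1983to89.B9Thm33BindersUniformZdPerNestedEta.IdxB8SubDPerκ.binders_uniform
      (P := M₁ * (stage3OfFamily F).L) (Mκ := M₁) (Rκ := R) τ hτp hτt hτs (by show 2 ≤ 4; norm_num) hCτ ops₀ 1 hβ hlen
  -- ζ-L's door with `a_S := a_T`, `C_β ↦ max C_β 1` (dag-n05-d's two glue lines), the Hölder binder weakened by `holderAtIH2Per_anti`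
  exact exists_residB8_slot8κ'_of_bindersLettersPer_doorL (stage3OfFamily F) (by show 2 ≤ 4; norm_num) (by have := F.hL11; show 5 ≤ F.L; omega) M₁ R hM₁
    τ hτp hτt hτs hCτ ops₀ le_rfl haI haT haT hB₀ (lt_max_of_lt_right one_pos) hcS hcSβ hB₀'H hB₂' hBG hBR hcL
    (fun a m hm => (hB a m hm).1) (fun a m hm => (hB a m hm).2.1) (fun a m hm => holderAtIH2Per_anti (ha := le_rfl) (hC := le_max_left Cβ 1) (h := (hB a m hm).2.2.1))
    (fun a m hm => (hB a m hm).2.2.2.1) (fun a m hm => (hB a m hm).2.2.2.2) hLet SLetUB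

end Summit.QuantumFields.YangMills.BalabanUVNodes.N24K1FaceN06BindersJunctionLSlot8KappaPrimeAtGaussPinPrintedZYP

end
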